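import Summits.QuantumFields.YangMills.Theorems.LuscherReductionDressedRitzRitzInterlacing
import HarnessLib

/-!
# Route `LuscherReduction`, items `DressedRitz` (stmt-QuantumFields-20205) ↔ `RunningReduction` (stmt-QuantumFields-19978) — the VARIATIONAL HALF of RED
# from the LOWER Lüscher position of a Ritz family, by Cauchy interlacing alone (no Kato–Temple, no residual or capture clause)

Support module (LEAD prover ym-lead-20205-polyakovlift g0; `--supports stmt-QuantumFields-20205`, helper).  `RunningReduction` (RED) is, level by level, the
conjunction of `λ_kμ₀ ≤ e^{Cλ²/L}μ_kλ₀` (fine excitation energies not too LOW — the spectral half) and `μ_kλ₀ ≤ e^{Cλ²/L}λ_kμ₀` (fine excitation energies not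
too HIGH — the variational half).  In the KTR skeleton `DressedRitz` feeds RED through Kato–Temple.  For the VARIATIONAL half nothing of that is needed:
`RitzInterlace.ritz_le_levelValue` (`ρ_j ≤ λ_j` for every `DressedRitzAt`-format family) and the LOWER half of the position clause
(`μ_jρ₀ ≤ e^{Cλ²/L}ρ_jμ₀`) with `ρ₀ = λ₀` give `μ_jλ₀ ≤ e^{Cλ²/L}λ_jμ₀` at once:

* ★ `redLower_of_ritzLower` — pointwise: family data + lower position at `j` ⟹ RED's variational inequality at level `j`.

(The UPPER halves of the position clause are the ones that carry spectral information into RED's other conjunct; they are NOT implied by anything cheaper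
inside the route — see the LEAD's erratum of 16:00Z: `RunningReduction → DressedRitz` is a tree certificate, so discharging them from RED is circular.)
HONEST FRAMING: fixed-lattice linear algebra on the conditional femto rung R2b1; nothing here bears on infinite volume, the continuum limit or the Clay gap.
References: B. N. Parlett, §10.1 [cite: Parlett1998, §10.1]; M. Lüscher, NPB 219 (1983) 233 [cite: Luscher1983, §3].
-/

set_option autoImplicit false

noncomputable section

open MeasureTheory Filter Topology Real
open Literature.MathematicalPhysics.QuantumFieldTheory (GaugeConfig Site gaugeTransform)
open scoped BigOperators

namespace Summit.QuantumFields.YangMills.Theorems.FemtoTransferGap.RitzInterlace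

open Summit.QuantumFields.YangMills.Theorems.FemtoTransferGap

/-- ★ **RED's variational inequality from a Ritz family in lower Lüscher position.**  For a physical, `l2`-orthonormal, `qform`-diagonal, antitone family
`φ₀ … φ_k` with `qform(φ₀,φ₀) = λ₀` and, at index `j`, the LOWER position `ν·qform(φ₀,φ₀) ≤ E·(qform(φ_j,φ_j)·m)` against reference values `ν`
(e.g. `μ_j(B)`) and `m ≥ 0` (e.g. `μ₀(B)`) with `E ≥ 0`: `ν·λ₀ ≤ E·(λ_j·m)`. [cite: Parlett1998, §10.1] [cite: Luscher1983, §3] -/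
theorem redLower_of_ritzLower {L : ℕ} [NeZero L] {β : ℝ} (hβ : 0 < β) {k : ℕ} {φ : Fin (k + 1) → (GaugeConfig 3 L SU2 → ℝ)}
    (hφ : ∀ i, IsPhys (φ i)) (hon : ∀ i l, l2 (φ i) (φ l) = if i = l then 1 else 0)
    (hdiag : ∀ i l, i ≠ l → qform su2Rep β (φ i) (φ l) = 0)
    (hanti : ∀ i l : Fin (k + 1), i ≤ l → qform su2Rep β (φ l) (φ l) ≤ qform su2Rep β (φ i) (φ i))
    (htop : qform su2Rep β (φ 0) (φ 0) = levelValue su2Rep L β 0) (j : Fin (k + 1)) {ν m E : ℝ} (hm : 0 ≤ m) (hE : 0 ≤ E)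
    (hlow : ν * qform su2Rep β (φ 0) (φ 0) ≤ E * (qform su2Rep β (φ j) (φ j) * m)) :
    ν * levelValue su2Rep L β 0 ≤ E * (levelValue su2Rep L β j * m) := by
  rw [htop] at hlow
  exact hlow.trans (mul_le_mul_of_nonneg_left (mul_le_mul_of_nonneg_right (ritz_le_levelValue hβ hφ hon hdiag hanti j) hm) hE)

/-- The same in RED's exact product format at level `j`: `μ_j(B)·λ₀ ≤ e^{Cλ²/L}·(λ_j·μ₀(B))`, `B = oneSiteCoupling β L` (one-site coupling `≥ 0`).
[cite: Luscher1983, §3] -/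
theorem redLower_of_ritzLower_window {L : ℕ} [NeZero L] {β : ℝ} (hβ : 0 < β) (hB : 0 ≤ oneSiteCoupling β L) {k : ℕ}
    {φ : Fin (k + 1) → (GaugeConfig 3 L SU2 → ℝ)}
    (hφ : ∀ i, IsPhys (φ i)) (hon : ∀ i l, l2 (φ i) (φ l) = if i = l then 1 else 0)
    (hdiag : ∀ i l, i ≠ l → qform su2Rep β (φ i) (φ l) = 0)
    (hanti : ∀ i l : Fin (k + 1), i ≤ l → qform su2Rep β (φ l) (φ l) ≤ qform su2Rep β (φ i) (φ i))
    (htop : qform su2Rep β (φ 0) (φ 0) = levelValue su2Rep L β 0) (C : ℝ) (j : Fin (k + 1))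
    (hlow : levelValue su2Rep 1 (oneSiteCoupling β L) j * qform su2Rep β (φ 0) (φ 0) ≤
      Real.exp (C * luscherLambda β L ^ 2 / L) * (qform su2Rep β (φ j) (φ j) * levelValue su2Rep 1 (oneSiteCoupling β L) 0)) :
    levelValue su2Rep 1 (oneSiteCoupling β L) j * levelValue su2Rep L β 0 ≤
      Real.exp (C * luscherLambda β L ^ 2 / L) * (levelValue su2Rep L β j * levelValue su2Rep 1 (oneSiteCoupling β L) 0) :=
  redLower_of_ritzLower hβ hφ hon hdiag hanti htop j (levelValue_su2Rep_nonneg 1 hB 0) (Real.exp_pos _).le hlow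

end Summit.QuantumFields.YangMills.Theorems.FemtoTransferGap.RitzInterlace

end
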